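import Summits.KontsevichZagierPeriods.KontsevichZagierPeriods.Theses.CommonUnfolding
import Literature.NumberTheory.Transcendental.KZLogCalculusProofs
import Literature.NumberTheory.Transcendental.KZFibredRelations

/-!
# `InterchangeLemma` (stmt-KontsevichZagierPeriods-4830, route CommonUnfolding) — proof

EVERY VALLEY IS A PEAK. Let `b₁ = [B₁, f₁]` and `b₃ = [B₃, f₃]` (dimension `n + 1`) both descend to
the same base `r₂ = [τ, g]` (dimension `n`) by one Newton–Leibniz move each: `Bᵢ` is the band
`{(x, t) | x ∈ τ, αᵢ x ≤ t ≤ βᵢ x}`, with `ℚ`-semialgebraic primitives `Fᵢ`, `∂ₜ Fᵢ = fᵢ` on the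
open fibres and `g = Fᵢ(·, βᵢ) − Fᵢ(·, αᵢ)`; assume all fibres are nondegenerate (`αᵢ < βᵢ` on `τ`,
which is what the two "`∃ t < t'`" hypotheses say). Put `hᵢ = 1 / (βᵢ − αᵢ)` and, on the double band
`D = {(x, t, s) | (x, t) ∈ B₁, α₃ x ≤ s ≤ β₃ x}`, the SIGNED COUPLING with prescribed marginals
`R(x, t, s) = f₁(x, t) h₃(x) + h₁(x) f₃(x, s) − g(x) h₁(x) h₃(x)`.
Integrating out `s` gives `f₁ + h₁ g − g h₁ = f₁` (primitive
`f₁ (s − α₃) h₃ + h₁ F₃ − g h₁ h₃ (s − α₃)`, semialgebraic, built from the GIVEN `F₃`), so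
`[D, R] − [b₁]` is a Newton–Leibniz move; after
swapping the last two coordinates (`R' = R.reindex (swap n (n+1))`, domain the double band over
`B₃` with fibres `[α₁ x, β₁ x]`) integrating out `t` gives `g h₃ + f₃ − g h₃ = f₃` (primitive
`F₁ h₃ + h₁ (t − α₁) f₃ − g h₁ h₃ (t − α₁)`), so `[R'] − [b₃]` is a Newton–Leibniz move. Absolute
integrability of `R`: `∫|R| ≤ ‖f₁‖₁ + ‖f₃‖₁ + ‖g‖₁` by Tonelli along the last coordinate (the
fibre integral of `φ(z)/(β − α)` over `[α, β]` is `|φ(z)|`), the middle term being transported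
through the measure-preserving coordinate swap. Semialgebraicity throughout is Tarski–Seidenberg
bookkeeping over `KZLogCalculusProofs` / `SemialgebraicMapsProofs`. No definitions are introduced.

References: M. Kontsevich, D. Zagier, *Periods* (2001), §1.2, rule 3); G. W. Anderson (1991)
(one integral in two orders); signed couplings with prescribed marginals are standard (Fréchet
classes).
-/

namespace Summit.KontsevichZagierPeriods.CommonUnfolding

open Set MeasureTheory
open Literature.NumberTheory.Transcendental
open Literature.ModelTheory.ExponentialFields (IsSemialgebraic)

/-- **Reading off Newton–Leibniz data.** If `[B] − [b] ∈ newtonLeibnizRel` with `B` of dimension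
`n + 1` and `b` of dimension `n`, then the move's data (bounds `a ≤ c`, primitive `F`) refer to `B`
and `b` themselves: the coefficients of `[B]` and `[b]` in the free abelian group identify the two
representations (`KZ.sigma_eq_of_of_sub_of_eq`). [Kontsevich–Zagier 2001, §1.2, rule 3)]
[folklore] -/
theorem nl_data {n : ℕ} {B : KZ.IntegralRep (n + 1)} {b : KZ.IntegralRep n}
    (h : KZ.of B - KZ.of b ∈ KZ.newtonLeibnizRel) :
    ∃ (a c : (Fin n → ℝ) → ℝ) (F : (Fin (n + 1) → ℝ) → ℝ),
      IsSemialgebraicFunOn ℚ B.domain F ∧ IsSemialgebraicFunOn ℚ b.domain a ∧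
      IsSemialgebraicFunOn ℚ b.domain c ∧ (∀ x ∈ b.domain, a x ≤ c x) ∧
      B.domain = KZlog.band b.domain a c ∧
      (∀ x ∈ b.domain, ContinuousOn (fun t : ℝ => F (Fin.snoc x t)) (Icc (a x) (c x))) ∧
      (∀ x ∈ b.domain, ∀ t ∈ Ioo (a x) (c x),
        HasDerivAt (fun s : ℝ => F (Fin.snoc x s)) (B.integrand (Fin.snoc x t)) t) ∧
      (∀ x ∈ b.domain, b.integrand x = F (Fin.snoc x (c x)) - F (Fin.snoc x (a x))) := by
  obtain ⟨m, ρ, ρ', a, c, F, hF, ha, hc, hle, hband, hcont, hderiv, hρ', h⟩ := h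
  have hne : (⟨n + 1, B⟩ : Σ k, KZ.IntegralRep k) ≠ ⟨n, b⟩ := fun h' => by
    have := congrArg Sigma.fst h'
    simp at this
  obtain ⟨h1, h2⟩ := KZ.sigma_eq_of_of_sub_of_eq hne h
  obtain ⟨rfl, h2'⟩ := Sigma.mk.inj_iff.mp h2
  obtain rfl := eq_of_heq h2'
  obtain ⟨-, h1'⟩ := Sigma.mk.inj_iff.mp h1
  obtain rfl := eq_of_heq h1'
  exact ⟨a, c, F, hF, ha, hc, hle, hband, hcont, hderiv, hρ'⟩

/-- **Tonelli on a band with nondegenerate fibres.** If `φ` is integrable on `S` and `a < b` on `S`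
(all `ℚ`-semialgebraic), then `(z, t) ↦ φ(z) / (b z − a z)` is integrable on the band
`{(z, t) | z ∈ S, a z ≤ t ≤ b z}`: its fibre integral over `[a z, b z]` is exactly `|φ z|`
(`KZlog.integrableOn_band_of_lintegral_fibre_le`). [folklore] -/
theorem integrableOn_band_div_width {m : ℕ} {S : Set (Fin m → ℝ)} (hS : IsSemialgebraic ℚ S)
    {a b φ : (Fin m → ℝ) → ℝ} (ha : IsSemialgebraicFunOn ℚ S a) (hb : IsSemialgebraicFunOn ℚ S b)
    (hab : ∀ z ∈ S, a z < b z) (hφ : IsSemialgebraicFunOn ℚ S φ) (hint : IntegrableOn φ S) :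
    IntegrableOn (fun w => φ (Fin.init w) * (b (Fin.init w) - a (Fin.init w))⁻¹)
      (KZlog.band S a b) := by
  have hBsa : IsSemialgebraic ℚ (KZlog.band S a b) := KZlog.isSemialgebraic_band ha hb
  have hBm : MeasurableSet (KZlog.band S a b) := hBsa.measurableSet_holds
  have hsub : KZlog.band S a b ⊆ {z | Fin.init z ∈ S} := KZ.band_subset_setOf_init_mem
  have hWsa : IsSemialgebraicFunOn ℚ (KZlog.band S a b)
      (fun w => φ (Fin.init w) * (b (Fin.init w) - a (Fin.init w))⁻¹) :=
    IsSemialgebraicFunOn.mul_holds (hφ.comp_init_mono hBsa hsub)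
      ((IsSemialgebraicFunOn.sub_holds (hb.comp_init_mono hBsa hsub)
        (ha.comp_init_mono hBsa hsub)).inv fun w hw => (sub_pos.2 (hab _ (hsub hw))).ne')
  refine KZlog.integrableOn_band_of_lintegral_fibre_le hS.measurableSet_holds hBm
    (fun x t => KZlog.snoc_mem_band) (KZ.aestronglyMeasurable_of_isSemialgebraicFunOn hWsa hBm)
    (fun z hz => ?_) hint
  have hw : 0 < b z - a z := sub_pos.2 (hab z hz)
  simp only [Fin.init_snoc]
  refine le_of_eq ?_
  rw [setLIntegral_const, Real.volume_Icc, Real.enorm_eq_ofReal_abs, Real.enorm_eq_ofReal_abs,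
    ← ENNReal.ofReal_mul (abs_nonneg _), abs_mul, abs_inv, abs_of_pos hw, mul_assoc,
    inv_mul_cancel₀ hw.ne', mul_one]

/-- **Relabelling the double band.** Swapping the last two coordinates carries the double band
over `{x ∈ τ, α₁ ≤ t ≤ β₁}` with fibres `[α₃ x, β₃ x]` onto the double band over
`{x ∈ τ, α₃ ≤ s ≤ β₃}` with fibres `[α₁ x, β₁ x]`. [folklore] -/
theorem setOf_comp_swap_mem_dband {n : ℕ} (τ : Set (Fin n → ℝ)) (α₁ β₁ α₃ β₃ : (Fin n → ℝ) → ℝ) :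
    {w : Fin (n + 2) → ℝ |
        (fun i => w (Equiv.swap (Fin.castSucc (Fin.last n)) (Fin.last (n + 1)) i)) ∈
          KZlog.band (KZlog.band τ α₁ β₁) (fun z => α₃ (Fin.init z)) (fun z => β₃ (Fin.init z))} =
      KZlog.band (KZlog.band τ α₃ β₃) (fun z => α₁ (Fin.init z)) (fun z => β₁ (Fin.init z)) := by
  ext w
  simp only [mem_setOf_eq, KZlog.mem_band, KZ.init_comp_swap, KZ.comp_swap_last, Fin.init_snoc,
    Fin.snoc_last]
  simp only [Fin.init]
  tauto

/-- **Semialgebraic bookkeeping on the double band** `D = {(x, t, s) | x ∈ τ, α₁ x ≤ t ≤ β₁ x,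
α₃ x ≤ s ≤ β₃ x}` (`αᵢ < βᵢ` on `τ`): `D` is `ℚ`-semialgebraic, and so are, as functions of
`(x, t, s) ∈ D`, the bound `α₃ x`, the inverse widths `1/(βᵢ x − αᵢ x)`, any `ℚ`-semialgebraic `g x`
of the base, and `φ(x, s)` for any `φ` `ℚ`-semialgebraic on the band `{x ∈ τ, α₃ x ≤ s ≤ β₃ x}`
(the last one through the coordinate swap, `IsSemialgebraicFunOn.comp_equiv`).
[Bochnak–Coste–Roy 1998, §2.2] [folklore] -/
theorem coupling_pieces {n : ℕ} {τ : Set (Fin n → ℝ)} {α₁ β₁ α₃ β₃ g : (Fin n → ℝ) → ℝ}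
    {φ : (Fin (n + 1) → ℝ) → ℝ} {D : Set (Fin (n + 2) → ℝ)}
    (hα₁ : IsSemialgebraicFunOn ℚ τ α₁) (hβ₁ : IsSemialgebraicFunOn ℚ τ β₁)
    (hα₃ : IsSemialgebraicFunOn ℚ τ α₃) (hβ₃ : IsSemialgebraicFunOn ℚ τ β₃)
    (hg : IsSemialgebraicFunOn ℚ τ g) (hlt₁ : ∀ x ∈ τ, α₁ x < β₁ x) (hlt₃ : ∀ x ∈ τ, α₃ x < β₃ x)
    (hφ : IsSemialgebraicFunOn ℚ (KZlog.band τ α₃ β₃) φ)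
    (hD : D = KZlog.band (KZlog.band τ α₁ β₁) (fun z => α₃ (Fin.init z))
      (fun z => β₃ (Fin.init z))) :
    IsSemialgebraic ℚ D ∧
    IsSemialgebraicFunOn ℚ D (fun w => α₃ (Fin.init (Fin.init w))) ∧
    IsSemialgebraicFunOn ℚ D
      (fun w => (β₁ (Fin.init (Fin.init w)) - α₁ (Fin.init (Fin.init w)))⁻¹) ∧
    IsSemialgebraicFunOn ℚ D
      (fun w => (β₃ (Fin.init (Fin.init w)) - α₃ (Fin.init (Fin.init w)))⁻¹) ∧
    IsSemialgebraicFunOn ℚ D (fun w => g (Fin.init (Fin.init w))) ∧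
    IsSemialgebraicFunOn ℚ D
      (fun w => φ (Fin.snoc (Fin.init (Fin.init w)) (w (Fin.last (n + 1))))) := by
  have hB₁ : IsSemialgebraic ℚ (KZlog.band τ α₁ β₁) := KZlog.isSemialgebraic_band hα₁ hβ₁
  have hDsa : IsSemialgebraic ℚ D := hD ▸ KZlog.isSemialgebraic_band
    (hα₃.comp_init_mono hB₁ KZ.band_subset_setOf_init_mem)
    (hβ₃.comp_init_mono hB₁ KZ.band_subset_setOf_init_mem)
  have hDτ : D ⊆ {w | Fin.init (Fin.init w) ∈ τ} := fun w hw => by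
    rw [hD] at hw
    exact hw.1.1
  have lift : ∀ {ψ : (Fin n → ℝ) → ℝ}, IsSemialgebraicFunOn ℚ τ ψ →
      IsSemialgebraicFunOn ℚ D (fun w => ψ (Fin.init (Fin.init w))) :=
    fun hψ => hψ.comp_init.comp_init.mono hDτ hDsa
  refine ⟨hDsa, lift hα₃,
    (IsSemialgebraicFunOn.sub_holds (lift hβ₁) (lift hα₁)).inv fun w hw =>
      (sub_pos.2 (hlt₁ _ (hDτ hw))).ne',
    (IsSemialgebraicFunOn.sub_holds (lift hβ₃) (lift hα₃)).inv fun w hw =>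
      (sub_pos.2 (hlt₃ _ (hDτ hw))).ne',
    lift hg, ?_⟩
  have h := hφ.comp_init.comp_equiv (Equiv.swap (Fin.castSucc (Fin.last n)) (Fin.last (n + 1)))
  refine (h.mono (fun w hw => ?_) hDsa).congr fun w _ => by simp only [KZ.init_comp_swap]
  rw [hD] at hw
  simp only [mem_setOf_eq, KZ.init_comp_swap, KZlog.snoc_mem_band]
  exact ⟨hw.1.1, hw.2.1, hw.2.2⟩

/-- **One Newton–Leibniz descent of the signed coupling.** With the notation of the module
docstring: if `R` has domain the double band `D` over `B₁ = {x ∈ τ, α₁ ≤ t ≤ β₁}` with fibres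
`[α₃ x, β₃ x]` and integrand `f₁(x,t) h₃(x) + f₃(x,s) h₁(x) − g(x) h₁(x) h₃(x)` on `D`, then
`[R] − [b₁] ∈ newtonLeibnizRel`: the `s`-primitive
`f₁ (s − α₃ x) h₃ + h₁ F₃(x, s) − g h₁ h₃ (s − α₃ x)` is `ℚ`-semialgebraic on `D`, continuous on
the closed fibres, has `s`-derivative the integrand on the open fibres (`∂ₛ F₃ = f₃`), and its
increment over `[α₃ x, β₃ x]` is
`f₁ + h₁ (F₃(x, β₃) − F₃(x, α₃)) − g h₁ = f₁ + h₁ g − g h₁ = f₁(x, t)`.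
[Kontsevich–Zagier 2001, §1.2, rule 3)] [folklore] -/
theorem of_sub_of_mem_newtonLeibnizRel_of_coupling {n : ℕ} {τ : Set (Fin n → ℝ)}
    {α₁ β₁ α₃ β₃ g : (Fin n → ℝ) → ℝ} {F₃ : (Fin (n + 1) → ℝ) → ℝ}
    {b₁ b₃ : KZ.IntegralRep (n + 1)} {R : KZ.IntegralRep (n + 2)}
    (hα₁ : IsSemialgebraicFunOn ℚ τ α₁) (hβ₁ : IsSemialgebraicFunOn ℚ τ β₁)
    (hα₃ : IsSemialgebraicFunOn ℚ τ α₃) (hβ₃ : IsSemialgebraicFunOn ℚ τ β₃)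
    (hg : IsSemialgebraicFunOn ℚ τ g)
    (hlt₁ : ∀ x ∈ τ, α₁ x < β₁ x) (hlt₃ : ∀ x ∈ τ, α₃ x < β₃ x)
    (hd₁ : b₁.domain = KZlog.band τ α₁ β₁) (hd₃ : b₃.domain = KZlog.band τ α₃ β₃)
    (hF₃ : IsSemialgebraicFunOn ℚ b₃.domain F₃)
    (hcont₃ : ∀ x ∈ τ, ContinuousOn (fun t : ℝ => F₃ (Fin.snoc x t)) (Icc (α₃ x) (β₃ x)))
    (hder₃ : ∀ x ∈ τ, ∀ t ∈ Ioo (α₃ x) (β₃ x),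
      HasDerivAt (fun s : ℝ => F₃ (Fin.snoc x s)) (b₃.integrand (Fin.snoc x t)) t)
    (hbase₃ : ∀ x ∈ τ, g x = F₃ (Fin.snoc x (β₃ x)) - F₃ (Fin.snoc x (α₃ x)))
    (hRd : R.domain = KZlog.band (KZlog.band τ α₁ β₁) (fun z => α₃ (Fin.init z))
      (fun z => β₃ (Fin.init z)))
    (hRi : ∀ w ∈ R.domain, R.integrand w =
      b₁.integrand (Fin.init w) * (β₃ (Fin.init (Fin.init w)) - α₃ (Fin.init (Fin.init w)))⁻¹ +
      b₃.integrand (Fin.snoc (Fin.init (Fin.init w)) (w (Fin.last (n + 1)))) *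
        (β₁ (Fin.init (Fin.init w)) - α₁ (Fin.init (Fin.init w)))⁻¹ -
      g (Fin.init (Fin.init w)) * (β₁ (Fin.init (Fin.init w)) - α₁ (Fin.init (Fin.init w)))⁻¹ *
        (β₃ (Fin.init (Fin.init w)) - α₃ (Fin.init (Fin.init w)))⁻¹) :
    KZ.of R - KZ.of b₁ ∈ KZ.newtonLeibnizRel := by
  have hRsa := R.isSemialgebraic_domain
  obtain ⟨-, hα₃'', hc₁, hc₃, hg'', hF₃'⟩ :=
    coupling_pieces hα₁ hβ₁ hα₃ hβ₃ hg hlt₁ hlt₃ (hd₃ ▸ hF₃) hRd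
  have hB₁τ : ∀ z ∈ b₁.domain, Fin.init z ∈ τ := fun z hz => by
    rw [hd₁] at hz
    exact hz.1
  have hRB₁ : R.domain ⊆ {w | Fin.init w ∈ b₁.domain} := by
    rw [hRd, hd₁]
    exact KZ.band_subset_setOf_init_mem
  have hf₁' : IsSemialgebraicFunOn ℚ R.domain fun w => b₁.integrand (Fin.init w) :=
    b₁.isSemialgebraicFunOn_integrand.comp_init.mono hRB₁ hRsa
  have hs : IsSemialgebraicFunOn ℚ R.domain fun w => w (Fin.last (n + 1)) :=
    isSemialgebraicFunOn_apply hRsa _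
  -- the `s`-primitive and its semialgebraicity
  have hGsa : IsSemialgebraicFunOn ℚ R.domain fun w =>
      b₁.integrand (Fin.init w) * (w (Fin.last (n + 1)) - α₃ (Fin.init (Fin.init w))) *
          (β₃ (Fin.init (Fin.init w)) - α₃ (Fin.init (Fin.init w)))⁻¹ +
        (β₁ (Fin.init (Fin.init w)) - α₁ (Fin.init (Fin.init w)))⁻¹ *
          F₃ (Fin.snoc (Fin.init (Fin.init w)) (w (Fin.last (n + 1)))) -
        g (Fin.init (Fin.init w)) * (β₁ (Fin.init (Fin.init w)) - α₁ (Fin.init (Fin.init w)))⁻¹ *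
          (β₃ (Fin.init (Fin.init w)) - α₃ (Fin.init (Fin.init w)))⁻¹ *
          (w (Fin.last (n + 1)) - α₃ (Fin.init (Fin.init w))) :=
    IsSemialgebraicFunOn.sub_holds
      (IsSemialgebraicFunOn.add_holds
        (IsSemialgebraicFunOn.mul_holds
          (IsSemialgebraicFunOn.mul_holds hf₁' (IsSemialgebraicFunOn.sub_holds hs hα₃'')) hc₃)
        (IsSemialgebraicFunOn.mul_holds hc₁ hF₃'))
      (IsSemialgebraicFunOn.mul_holds
        (IsSemialgebraicFunOn.mul_holds (IsSemialgebraicFunOn.mul_holds hg'' hc₁) hc₃)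
        (IsSemialgebraicFunOn.sub_holds hs hα₃''))
  refine ⟨n + 1, R, b₁, fun z => α₃ (Fin.init z), fun z => β₃ (Fin.init z), _, hGsa,
    hα₃.comp_init.mono hB₁τ b₁.isSemialgebraic_domain,
    hβ₃.comp_init.mono hB₁τ b₁.isSemialgebraic_domain,
    fun z hz => (hlt₃ _ (hB₁τ z hz)).le, by rw [hRd, hd₁]; rfl, fun z hz => ?_,
    fun z hz t ht => ?_, fun z hz => ?_, rfl⟩
  · -- continuity of the primitive on the closed fibre
    have hx := hB₁τ z hz
    simp only [Fin.init_snoc, Fin.snoc_last]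
    exact (((continuousOn_const.mul (continuousOn_id.sub continuousOn_const)).mul
      continuousOn_const).add (continuousOn_const.mul (hcont₃ _ hx))).sub
      (continuousOn_const.mul (continuousOn_id.sub continuousOn_const))
  · -- its derivative along the open fibre is the coupling integrand
    have hx := hB₁τ z hz
    have hzt : (Fin.snoc z t : Fin (n + 2) → ℝ) ∈ R.domain := by
      rw [hRd, KZlog.snoc_mem_band, ← hd₁]
      exact ⟨hz, Ioo_subset_Icc_self ht⟩
    rw [hRi _ hzt]
    simp only [Fin.init_snoc, Fin.snoc_last]
    refine ((((((hasDerivAt_id' t).sub_const _).const_mul _).mul_const _).add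
      ((hder₃ _ hx t ht).const_mul _)).sub
      (((hasDerivAt_id' t).sub_const _).const_mul _)).congr_deriv ?_
    ring
  · -- its increment over the fibre is `f₁`
    have hx := hB₁τ z hz
    have h1 : β₁ (Fin.init z) - α₁ (Fin.init z) ≠ 0 := (sub_pos.2 (hlt₁ _ hx)).ne'
    have h3 : β₃ (Fin.init z) - α₃ (Fin.init z) ≠ 0 := (sub_pos.2 (hlt₃ _ hx)).ne'
    simp only [Fin.init_snoc, Fin.snoc_last]
    rw [hbase₃ _ hx]
    field_simp
    ring

/-- **`InterchangeLemma`** (route CommonUnfolding, stmt-KontsevichZagierPeriods-4830): every valley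
is a peak. If `b₁` and `b₃` (dimension `n + 1`) both descend to the same base `r₂` (dimension `n`)
by one Newton–Leibniz move each, and all fibres of both bands over `r₂.domain` are nondegenerate,
then the signed coupling `R = [D, f₁ h₃ + h₁ f₃ − g h₁ h₃]` on the double band descends to `b₁` by
one Newton–Leibniz move, its coordinate swap `R' = R.reindex (swap n (n+1))` descends to `b₃` by
one Newton–Leibniz move, and `R'` is the image of `R` under the swap of the last two coordinates
(domain and integrand). Integrability of `R` is Tonelli along the last coordinate, term by term,
the `f₃`-term through the measure-preserving swap. [Kontsevich–Zagier 2001, §1.2, rule 3)]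
[folklore] -/
theorem interchangeLemma_proof :
    Summit.KontsevichZagierPeriods.KontsevichZagierPeriods.Theses.CommonUnfolding.InterchangeLemma := by
  intro n r₂ b₁ b₃ h₁ h₃ hne₁ hne₃
  obtain ⟨α₁, β₁, F₁, hF₁, hα₁, hβ₁, -, hd₁, hcont₁, hder₁, hbase₁⟩ := nl_data h₁
  obtain ⟨α₃, β₃, F₃, hF₃, hα₃, hβ₃, -, hd₃, hcont₃, hder₃, hbase₃⟩ := nl_data h₃
  have hlt₁ : ∀ x ∈ r₂.domain, α₁ x < β₁ x := fun x hx => by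
    obtain ⟨t, t', htt', ht, ht'⟩ := hne₁ x hx
    rw [hd₁, KZlog.snoc_mem_band] at ht ht'
    exact (ht.2.1.trans_lt htt').trans_le ht'.2.2
  have hlt₃ : ∀ x ∈ r₂.domain, α₃ x < β₃ x := fun x hx => by
    obtain ⟨t, t', htt', ht, ht'⟩ := hne₃ x hx
    rw [hd₃, KZlog.snoc_mem_band] at ht ht'
    exact (ht.2.1.trans_lt htt').trans_le ht'.2.2
  have hτsa := r₂.isSemialgebraic_domain
  have hg := r₂.isSemialgebraicFunOn_integrand
  have hB₁sa : IsSemialgebraic ℚ (KZlog.band r₂.domain α₁ β₁) := KZlog.isSemialgebraic_band hα₁ hβ₁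
  have hB₃sa : IsSemialgebraic ℚ (KZlog.band r₂.domain α₃ β₃) := KZlog.isSemialgebraic_band hα₃ hβ₃
  have hf₁sa : IsSemialgebraicFunOn ℚ (KZlog.band r₂.domain α₁ β₁) b₁.integrand :=
    hd₁ ▸ b₁.isSemialgebraicFunOn_integrand
  have hf₃sa : IsSemialgebraicFunOn ℚ (KZlog.band r₂.domain α₃ β₃) b₃.integrand :=
    hd₃ ▸ b₃.isSemialgebraicFunOn_integrand
  have hf₁i : IntegrableOn b₁.integrand (KZlog.band r₂.domain α₁ β₁) := hd₁ ▸ b₁.integrableOn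
  have hf₃i : IntegrableOn b₃.integrand (KZlog.band r₂.domain α₃ β₃) := hd₃ ▸ b₃.integrableOn
  -- semialgebraic bookkeeping on the double band `D` and on its swap `D'`
  obtain ⟨hDsa, -, hc₁, hc₃, hg'', hf₃''⟩ :=
    coupling_pieces hα₁ hβ₁ hα₃ hβ₃ hg hlt₁ hlt₃ hf₃sa rfl
  obtain ⟨hD'sa, -, -, hc₁', -, -⟩ :=
    coupling_pieces hα₃ hβ₃ hα₁ hβ₁ hg hlt₃ hlt₁ hf₁sa rfl
  have hα₃' : IsSemialgebraicFunOn ℚ (KZlog.band r₂.domain α₁ β₁) fun z => α₃ (Fin.init z) :=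
    hα₃.comp_init_mono hB₁sa KZ.band_subset_setOf_init_mem
  have hβ₃' : IsSemialgebraicFunOn ℚ (KZlog.band r₂.domain α₁ β₁) fun z => β₃ (Fin.init z) :=
    hβ₃.comp_init_mono hB₁sa KZ.band_subset_setOf_init_mem
  have hα₁' : IsSemialgebraicFunOn ℚ (KZlog.band r₂.domain α₃ β₃) fun z => α₁ (Fin.init z) :=
    hα₁.comp_init_mono hB₃sa KZ.band_subset_setOf_init_mem
  have hβ₁' : IsSemialgebraicFunOn ℚ (KZlog.band r₂.domain α₃ β₃) fun z => β₁ (Fin.init z) :=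
    hβ₁.comp_init_mono hB₃sa KZ.band_subset_setOf_init_mem
  have hlt₃' : ∀ z ∈ KZlog.band r₂.domain α₁ β₁, α₃ (Fin.init z) < β₃ (Fin.init z) :=
    fun z hz => hlt₃ _ hz.1
  have hlt₁' : ∀ z ∈ KZlog.band r₂.domain α₃ β₃, α₁ (Fin.init z) < β₁ (Fin.init z) :=
    fun z hz => hlt₁ _ hz.1
  -- integrability of the three pieces of the coupling (Tonelli along the last coordinate)
  have hT₁ : IntegrableOn (fun w : Fin (n + 2) → ℝ => b₁.integrand (Fin.init w) *
      (β₃ (Fin.init (Fin.init w)) - α₃ (Fin.init (Fin.init w)))⁻¹)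
      (KZlog.band (KZlog.band r₂.domain α₁ β₁) (fun z => α₃ (Fin.init z))
        (fun z => β₃ (Fin.init z))) :=
    integrableOn_band_div_width hB₁sa hα₃' hβ₃' hlt₃' hf₁sa hf₁i
  have hφsa : IsSemialgebraicFunOn ℚ (KZlog.band r₂.domain α₁ β₁) fun z =>
      r₂.integrand (Fin.init z) * (β₁ (Fin.init z) - α₁ (Fin.init z))⁻¹ :=
    IsSemialgebraicFunOn.mul_holds (hg.comp_init_mono hB₁sa KZ.band_subset_setOf_init_mem)
      ((IsSemialgebraicFunOn.sub_holds (hβ₁.comp_init_mono hB₁sa KZ.band_subset_setOf_init_mem)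
        (hα₁.comp_init_mono hB₁sa KZ.band_subset_setOf_init_mem)).inv
        fun z hz => (sub_pos.2 (hlt₁ _ hz.1)).ne')
  have hT₃ : IntegrableOn (fun w : Fin (n + 2) → ℝ => r₂.integrand (Fin.init (Fin.init w)) *
      (β₁ (Fin.init (Fin.init w)) - α₁ (Fin.init (Fin.init w)))⁻¹ *
      (β₃ (Fin.init (Fin.init w)) - α₃ (Fin.init (Fin.init w)))⁻¹)
      (KZlog.band (KZlog.band r₂.domain α₁ β₁) (fun z => α₃ (Fin.init z))
        (fun z => β₃ (Fin.init z))) :=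
    integrableOn_band_div_width hB₁sa hα₃' hβ₃' hlt₃' hφsa
      (integrableOn_band_div_width hτsa hα₁ hβ₁ hlt₁ hg r₂.integrableOn)
  have hT₂'sa : IsSemialgebraicFunOn ℚ (KZlog.band (KZlog.band r₂.domain α₃ β₃)
      (fun z => α₁ (Fin.init z)) (fun z => β₁ (Fin.init z))) fun w =>
      b₃.integrand (Fin.init w) * (β₁ (Fin.init (Fin.init w)) - α₁ (Fin.init (Fin.init w)))⁻¹ :=
    IsSemialgebraicFunOn.mul_holds (hf₃sa.comp_init_mono hD'sa KZ.band_subset_setOf_init_mem) hc₁'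
  have hT₂ : IntegrableOn (fun w : Fin (n + 2) → ℝ =>
      b₃.integrand (Fin.snoc (Fin.init (Fin.init w)) (w (Fin.last (n + 1)))) *
        (β₁ (Fin.init (Fin.init w)) - α₁ (Fin.init (Fin.init w)))⁻¹)
      (KZlog.band (KZlog.band r₂.domain α₁ β₁) (fun z => α₃ (Fin.init z))
        (fun z => β₃ (Fin.init z))) := by
    have hQ : IntegrableOn (fun w : Fin (n + 2) → ℝ => (fun w' : Fin (n + 2) → ℝ =>
        b₃.integrand (Fin.init w') * (β₁ (Fin.init (Fin.init w')) - α₁ (Fin.init (Fin.init w')))⁻¹)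
          (fun i => w (Equiv.swap (Fin.castSucc (Fin.last n)) (Fin.last (n + 1)) i)))
        {w | (fun i => w (Equiv.swap (Fin.castSucc (Fin.last n)) (Fin.last (n + 1)) i)) ∈
          KZlog.band (KZlog.band r₂.domain α₃ β₃) (fun z => α₁ (Fin.init z))
            (fun z => β₁ (Fin.init z))} :=
      (KZ.IntegralRep.reindex ⟨_, _, hD'sa, hT₂'sa,
        integrableOn_band_div_width hB₃sa hα₁' hβ₁' hlt₁' hf₃sa hf₃i⟩
        (Equiv.swap (Fin.castSucc (Fin.last n)) (Fin.last (n + 1)))).integrableOn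
    rw [setOf_comp_swap_mem_dband] at hQ
    refine hQ.congr_fun (fun w _ => ?_) hDsa.measurableSet_holds
    simp only [KZ.init_comp_swap, Fin.init_snoc]
  -- the peak `R = [D, f₁ h₃ + f₃ h₁ − g h₁ h₃]`
  have hRsa : IsSemialgebraicFunOn ℚ (KZlog.band (KZlog.band r₂.domain α₁ β₁)
      (fun z => α₃ (Fin.init z)) (fun z => β₃ (Fin.init z))) fun w =>
      b₁.integrand (Fin.init w) * (β₃ (Fin.init (Fin.init w)) - α₃ (Fin.init (Fin.init w)))⁻¹ +
      b₃.integrand (Fin.snoc (Fin.init (Fin.init w)) (w (Fin.last (n + 1)))) *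
        (β₁ (Fin.init (Fin.init w)) - α₁ (Fin.init (Fin.init w)))⁻¹ -
      r₂.integrand (Fin.init (Fin.init w)) *
        (β₁ (Fin.init (Fin.init w)) - α₁ (Fin.init (Fin.init w)))⁻¹ *
        (β₃ (Fin.init (Fin.init w)) - α₃ (Fin.init (Fin.init w)))⁻¹ :=
    IsSemialgebraicFunOn.sub_holds
      (IsSemialgebraicFunOn.add_holds
        (IsSemialgebraicFunOn.mul_holds
          (hf₁sa.comp_init_mono hDsa KZ.band_subset_setOf_init_mem) hc₃)
        (IsSemialgebraicFunOn.mul_holds hf₃'' hc₁))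
      (IsSemialgebraicFunOn.mul_holds (IsSemialgebraicFunOn.mul_holds hg'' hc₁) hc₃)
  obtain ⟨R, hRd, hRi⟩ : ∃ R : KZ.IntegralRep (n + 2),
      R.domain = KZlog.band (KZlog.band r₂.domain α₁ β₁) (fun z => α₃ (Fin.init z))
        (fun z => β₃ (Fin.init z)) ∧
      R.integrand = fun w =>
        b₁.integrand (Fin.init w) * (β₃ (Fin.init (Fin.init w)) - α₃ (Fin.init (Fin.init w)))⁻¹ +
        b₃.integrand (Fin.snoc (Fin.init (Fin.init w)) (w (Fin.last (n + 1)))) *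
          (β₁ (Fin.init (Fin.init w)) - α₁ (Fin.init (Fin.init w)))⁻¹ -
        r₂.integrand (Fin.init (Fin.init w)) *
          (β₁ (Fin.init (Fin.init w)) - α₁ (Fin.init (Fin.init w)))⁻¹ *
          (β₃ (Fin.init (Fin.init w)) - α₃ (Fin.init (Fin.init w)))⁻¹ :=
    ⟨⟨_, _, hDsa, hRsa, (hT₁.add hT₂).sub hT₃⟩, rfl, rfl⟩
  -- the two descents
  have H₁ : KZ.of R - KZ.of b₁ ∈ KZ.newtonLeibnizRel :=
    of_sub_of_mem_newtonLeibnizRel_of_coupling hα₁ hβ₁ hα₃ hβ₃ hg hlt₁ hlt₃ hd₁ hd₃ hF₃ hcont₃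
      hder₃ hbase₃ hRd fun w _ => by rw [hRi]
  have hR'd : (R.reindex (Equiv.swap (Fin.castSucc (Fin.last n)) (Fin.last (n + 1)))).domain =
      KZlog.band (KZlog.band r₂.domain α₃ β₃) (fun z => α₁ (Fin.init z))
        (fun z => β₁ (Fin.init z)) := by
    rw [KZ.IntegralRep.reindex_domain, hRd]
    exact setOf_comp_swap_mem_dband _ _ _ _ _
  have H₃ : KZ.of (R.reindex (Equiv.swap (Fin.castSucc (Fin.last n)) (Fin.last (n + 1)))) -
      KZ.of b₃ ∈ KZ.newtonLeibnizRel := by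
    refine of_sub_of_mem_newtonLeibnizRel_of_coupling hα₃ hβ₃ hα₁ hβ₁ hg hlt₃ hlt₁ hd₃ hd₁ hF₁
      hcont₁ hder₁ hbase₁ hR'd fun w _ => ?_
    have hsw : (Fin.snoc (Fin.init (Fin.init w)) (w (Fin.castSucc (Fin.last n))) :
        Fin (n + 1) → ℝ) = Fin.init w := Fin.snoc_init_self _
    rw [KZ.IntegralRep.reindex_integrand, hRi]
    simp only [KZ.init_comp_swap, KZ.comp_swap_last, Fin.init_snoc, hsw]
    ring
  refine ⟨R, R.reindex (Equiv.swap (Fin.castSucc (Fin.last n)) (Fin.last (n + 1))), H₁, H₃,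
    ?_, fun w _ => ?_⟩
  · -- the domain of `R'` is the swap image of `D`
    ext w
    simp only [KZ.IntegralRep.reindex_domain, mem_setOf_eq, mem_image]
    constructor
    · intro hw
      exact ⟨_, hw, funext fun i => by simp⟩
    · rintro ⟨v, hv, rfl⟩
      simpa using hv
  · -- the integrands agree along the swap
    simp [KZ.IntegralRep.reindex_integrand]

end Summit.KontsevichZagierPeriods.CommonUnfolding
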